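import Literature.Probability.Percolation.CellQuad
import Literature.Topology.PlaneTopology.RectangleDuality
import HarnessLib

/-!
# Local star-shapedness and edge-tameness of cell complexes

Topic `Probability/Percolation`.  Fourth step of the cell-complex toolkit for the quads of the gluing
theorem (Schramm–Smirnov 2011, proof of Thm 1.5): the two geometric hypotheses of the tame one-sided
continuity lemma (`measureReal_symmDiff_le_mul_of_isPerturbationTwo_tame'`, `QuadAlignedCaseTwo.lean`)
for unions `K = Kset U` of closed unit cells.

* `exists_star_Kset` — **local star-shapedness**: every point `x` has `r > 0` such that the segment
  from `x` to any point of `K ∩ B(x, r)` lies in `K` (cells not containing `x` are at positive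
  distance; cells containing `x` are convex);
* `isPreconnected_seg2_inter_Kset` — **tameness for two-step centre segments**: for cells
  `c`, `c + e`, `c + 2e` in a row or column, if `c, c + 2e ∈ U` forces `c + e ∈ U` ("no slit"), the
  segment joining the centres of `c` and `c + 2e` meets `K` in a preconnected set.  With the
  percolation lattice drawn through the cell centres of one parity class (vertices at the centres
  of the cells `(2a, 2b)`), these are exactly the drawn lattice edges.

Everything is proved; no named fact is introduced.

## References

* O. Schramm, S. Smirnov, Ann. Probab. 39 (2011), arXiv:1101.5820, proof of Thm 1.5 and Lemma 6.1. [SchrammSmirnov2011]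
-/

noncomputable section

open Set Metric
open Literature.Probability.LatticeModels

namespace Literature.Probability.Percolation

namespace CellComplex

/-! ### Local star-shapedness -/

/-- Closed cells are convex. [folklore] -/
theorem convex_sqCell (c : Site 2) : Convex ℝ (sqCell c) :=
  Literature.Topology.PlaneTopology.convex_Icc_reProdIm_Icc _ _ _ _

/-- **`K` is locally star-shaped** (at every point of the plane, vacuously off `K`). [folklore] -/
theorem exists_star_Kset (U : Finset (Site 2)) (x : ℂ) :
    ∃ r > 0, ∀ u ∈ Kset U, u ∈ ball x r → segment ℝ x u ⊆ Kset U := by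
  classical
  -- cells of `U` not containing `x` are at positive distance from `x`
  set V : Finset (Site 2) := U.filter fun c => x ∉ sqCell c with hV
  have hpos : ∀ c ∈ V, 0 < infDist x (sqCell c) := by
    intro c hc
    rw [hV, Finset.mem_filter] at hc
    have hne : (sqCell c).Nonempty := ⟨Site.toComplex c, by
      rw [sqCell, Complex.mem_reProdIm, mem_Icc, mem_Icc, Site.toComplex_re, Site.toComplex_im]
      refine ⟨⟨le_rfl, by linarith⟩, le_rfl, by linarith⟩⟩
    exact ((isCompact_sqCell c).isClosed.notMem_iff_infDist_pos hne).1 hc.2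
  obtain ⟨r, hr, hrV⟩ : ∃ r > 0, ∀ c ∈ V, r ≤ infDist x (sqCell c) := by
    rcases V.eq_empty_or_nonempty with hVe | hVne
    · exact ⟨1, one_pos, fun c hc => by rw [hVe] at hc; exact absurd hc (Finset.notMem_empty c)⟩
    · obtain ⟨c₀, hc₀, hmin⟩ := V.exists_min_image (fun c => infDist x (sqCell c)) hVne
      exact ⟨infDist x (sqCell c₀), hpos c₀ hc₀, fun c hc => hmin c hc⟩
  refine ⟨r, hr, fun u hu hux => ?_⟩
  rw [Kset, mem_iUnion₂] at hu
  obtain ⟨c, hc, huc⟩ := hu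
  -- the cell of `u` contains `x`
  have hxc : x ∈ sqCell c := by
    by_contra hxc
    have hcV : c ∈ V := by rw [hV, Finset.mem_filter]; exact ⟨hc, hxc⟩
    have h1 : infDist x (sqCell c) ≤ dist x u := infDist_le_dist_of_mem huc
    have h2 : dist x u < r := by rw [dist_comm]; exact mem_ball.1 hux
    linarith [hrV c hcV]
  exact ((convex_sqCell c).segment_subset hxc huc).trans (sqCell_subset_Kset hc)

/-! ### Two-step centre segments meet `K` in an interval -/

/-- The point at parameter `t` of the segment from the centre of `c` towards `c + 2e`
(`e = cornerUnit k`). [folklore] -/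
def seg2Pt (c : Site 2) (k : Fin 4) (t : ℝ) : ℂ := ctr c + ((2 * t : ℝ) : ℂ) * Site.toComplex (cornerUnit k)

/-- The two-step centre segment is the image of `[0, 1]`. [folklore] -/
theorem segment_ctr_eq_image (c : Site 2) (k : Fin 4) :
    segment ℝ (ctr c) (ctr (c + cornerUnit k + cornerUnit k)) = seg2Pt c k '' Icc 0 1 := by
  rw [segment_eq_image_lineMap]
  refine image_congr fun t _ => ?_
  simp only [AffineMap.lineMap_apply_module', seg2Pt, ctr, toComplex_add, Complex.real_smul]
  push_cast
  ring

/-- `seg2Pt` is continuous in `t`. [folklore] -/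
theorem continuous_seg2Pt (c : Site 2) (k : Fin 4) : Continuous (seg2Pt c k) := by
  unfold seg2Pt; fun_prop

/-- The coordinates of the unit vectors. [folklore] -/
theorem cornerUnit_apply_zero (j : Fin 4) :
    (cornerUnit j) 0 = (match j with | 0 => 1 | 1 => 0 | 2 => -1 | 3 => 0 : ℤ) := by
  fin_cases j <;> simp [cornerUnit]

/-- The coordinates of the unit vectors. [folklore] -/
theorem cornerUnit_apply_one (j : Fin 4) :
    (cornerUnit j) 1 = (match j with | 0 => 0 | 1 => 1 | 2 => 0 | 3 => -1 : ℤ) := by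
  fin_cases j <;> simp [cornerUnit]

/-- **Only the three cells of the row/column meet the two-step segment**: if `seg2Pt c k t`
(`t ∈ [0,1]`) lies in the closed cell `c'`, then `c' = c + j • e` for some `j ≤ 2`. [folklore] -/
theorem exists_of_seg2Pt_mem_sqCell {c c' : Site 2} {k : Fin 4} {t : ℝ} (ht : t ∈ Icc (0 : ℝ) 1)
    (h : seg2Pt c k t ∈ sqCell c') :
    c' = c ∨ c' = c + cornerUnit k ∨ c' = c + cornerUnit k + cornerUnit k := by
  have hv : ∀ w : Site 2, c' = w ↔ (c' 0 = w 0 ∧ c' 1 = w 1) := fun w =>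
    ⟨fun h => by subst h; exact ⟨rfl, rfl⟩, fun h => by funext i; fin_cases i <;> simp [h.1, h.2]⟩
  rw [sqCell, Complex.mem_reProdIm, mem_Icc, mem_Icc] at h
  simp only [seg2Pt, Complex.add_re, Complex.add_im, Complex.mul_re, Complex.mul_im,
    Complex.ofReal_re, Complex.ofReal_im, zero_mul, sub_zero, add_zero, ctr_re, ctr_im] at h
  rw [hv, hv, hv]
  simp only [Pi.add_apply, cornerUnit_apply_zero, cornerUnit_apply_one]
  obtain ⟨ht0, ht1⟩ := ht
  obtain ⟨⟨h1, h2⟩, h3, h4⟩ := h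
  fin_cases k <;> norm_num [toComplex_cornerUnit_table] at h1 h2 h3 h4 ⊢
  · -- east: `im` fixes the row, `re` one of three columns
    have a : (c' 1 : ℝ) < c 1 + 1 := by linarith
    have b : (c 1 : ℝ) < c' 1 + 1 := by linarith
    have a' : c' 1 < c 1 + 1 := by exact_mod_cast a
    have b' : c 1 < c' 1 + 1 := by exact_mod_cast b
    have e1 : c' 1 = c 1 := by omega
    have x1 : (c' 0 : ℝ) < c 0 + 3 := by linarith
    have x2 : (c 0 : ℝ) < c' 0 + 1 := by linarith
    have x1' : c' 0 < c 0 + 3 := by exact_mod_cast x1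
    have x2' : c 0 < c' 0 + 1 := by exact_mod_cast x2
    omega
  · have a : (c' 0 : ℝ) < c 0 + 1 := by linarith
    have b : (c 0 : ℝ) < c' 0 + 1 := by linarith
    have a' : c' 0 < c 0 + 1 := by exact_mod_cast a
    have b' : c 0 < c' 0 + 1 := by exact_mod_cast b
    have e0 : c' 0 = c 0 := by omega
    have x1 : (c' 1 : ℝ) < c 1 + 3 := by linarith
    have x2 : (c 1 : ℝ) < c' 1 + 1 := by linarith
    have x1' : c' 1 < c 1 + 3 := by exact_mod_cast x1
    have x2' : c 1 < c' 1 + 1 := by exact_mod_cast x2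
    omega
  · have a : (c' 1 : ℝ) < c 1 + 1 := by linarith
    have b : (c 1 : ℝ) < c' 1 + 1 := by linarith
    have a' : c' 1 < c 1 + 1 := by exact_mod_cast a
    have b' : c 1 < c' 1 + 1 := by exact_mod_cast b
    have e1 : c' 1 = c 1 := by omega
    have x1 : (c' 0 : ℝ) < c 0 + 1 := by linarith
    have x2 : (c 0 : ℝ) < c' 0 + 3 := by linarith
    have x1' : c' 0 < c 0 + 1 := by exact_mod_cast x1
    have x2' : c 0 < c' 0 + 3 := by exact_mod_cast x2
    omega
  · have a : (c' 0 : ℝ) < c 0 + 1 := by linarith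
    have b : (c 0 : ℝ) < c' 0 + 1 := by linarith
    have a' : c' 0 < c 0 + 1 := by exact_mod_cast a
    have b' : c 0 < c' 0 + 1 := by exact_mod_cast b
    have e0 : c' 0 = c 0 := by omega
    have x1 : (c' 1 : ℝ) < c 1 + 1 := by linarith
    have x2 : (c 1 : ℝ) < c' 1 + 3 := by linarith
    have x1' : c' 1 < c 1 + 1 := by exact_mod_cast x1
    have x2' : c 1 < c' 1 + 3 := by exact_mod_cast x2
    omega

/-- The point at parameter `1/4` lies in the cells `c` and `c + e`; the point at `3/4` in `c + e`
and `c + 2e`. [folklore] -/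
theorem seg2Pt_quarter_mem (c : Site 2) (k : Fin 4) :
    seg2Pt c k (1 / 4) ∈ sqCell c ∧ seg2Pt c k (1 / 4) ∈ sqCell (c + cornerUnit k) ∧
      seg2Pt c k (3 / 4) ∈ sqCell (c + cornerUnit k) ∧
        seg2Pt c k (3 / 4) ∈ sqCell (c + cornerUnit k + cornerUnit k) := by
  have key : ∀ (t : ℝ) (c' : Site 2), ((c' 0 : ℝ) ≤ (ctr c).re + 2 * t * (Site.toComplex (cornerUnit k)).re ∧
      (ctr c).re + 2 * t * (Site.toComplex (cornerUnit k)).re ≤ c' 0 + 1) →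
      ((c' 1 : ℝ) ≤ (ctr c).im + 2 * t * (Site.toComplex (cornerUnit k)).im ∧
      (ctr c).im + 2 * t * (Site.toComplex (cornerUnit k)).im ≤ c' 1 + 1) → seg2Pt c k t ∈ sqCell c' := by
    intro t c' h0 h1
    rw [sqCell, Complex.mem_reProdIm, mem_Icc, mem_Icc]
    simp only [seg2Pt, Complex.add_re, Complex.add_im, Complex.mul_re, Complex.mul_im,
      Complex.ofReal_re, Complex.ofReal_im, zero_mul, sub_zero, add_zero]
    exact ⟨h0, h1⟩
  refine ⟨key _ _ ?_ ?_, key _ _ ?_ ?_, key _ _ ?_ ?_, key _ _ ?_ ?_⟩ <;>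
    simp only [ctr_re, ctr_im, Pi.add_apply, cornerUnit_apply_zero, cornerUnit_apply_one] <;>
    fin_cases k <;> norm_num [toComplex_cornerUnit_table] <;> (first | (constructor <;> linarith) | linarith)

/-- The piece of the two-step segment inside one closed cell is preconnected (convex). [folklore] -/
theorem isPreconnected_seg2_inter_sqCell (c : Site 2) (k : Fin 4) (c' : Site 2) :
    IsPreconnected (seg2Pt c k '' Icc 0 1 ∩ sqCell c') := by
  rw [← segment_ctr_eq_image]
  exact ((convex_segment _ _).inter (convex_sqCell c')).isPreconnected

/-- **Tameness of two-step centre segments.**  If `c ∈ U` and `c + 2e ∈ U` force `c + e ∈ U`, the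
segment from the centre of `c` to the centre of `c + 2e` meets `K` in a preconnected set.
[cite: SchrammSmirnov2011, proof of Lemma 6.1 (lattice-tame quads)] -/
theorem isPreconnected_seg2_inter_Kset (U : Finset (Site 2)) (c : Site 2) (k : Fin 4)
    (hslit : c ∈ U → c + cornerUnit k + cornerUnit k ∈ U → c + cornerUnit k ∈ U) :
    IsPreconnected (segment ℝ (ctr c) (ctr (c + cornerUnit k + cornerUnit k)) ∩ Kset U) := by
  classical
  set S := seg2Pt c k '' Icc 0 1 with hS
  rw [segment_ctr_eq_image]
  set m := c + cornerUnit k with hm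
  set q := c + cornerUnit k + cornerUnit k with hq
  set A : Set ℂ := if c ∈ U then S ∩ sqCell c else ∅ with hA
  set B : Set ℂ := if m ∈ U then S ∩ sqCell m else ∅ with hB
  set C : Set ℂ := if q ∈ U then S ∩ sqCell q else ∅ with hC
  -- `S ∩ K = A ∪ B ∪ C`
  have hpiece : ∀ (x : Site 2) (X : Set ℂ), X = (if x ∈ U then S ∩ sqCell x else ∅) → X ⊆ S ∩ Kset U := by
    intro x X hX
    rw [hX]
    split_ifs with hx
    · exact inter_subset_inter_right _ (sqCell_subset_Kset hx)
    · exact empty_subset _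
  have heq : S ∩ Kset U = A ∪ B ∪ C := by
    apply Subset.antisymm
    · rintro p ⟨hpS, hpK⟩
      rw [Kset, mem_iUnion₂] at hpK
      obtain ⟨c', hc', hpc'⟩ := hpK
      obtain ⟨t, ht, rfl⟩ := hpS
      rcases exists_of_seg2Pt_mem_sqCell ht hpc' with rfl | rfl | rfl
      · left; left; rw [hA, if_pos hc']; exact ⟨⟨t, ht, rfl⟩, hpc'⟩
      · left; right; rw [hB, if_pos hc']; exact ⟨⟨t, ht, rfl⟩, hpc'⟩
      · right; rw [hC, if_pos hc']; exact ⟨⟨t, ht, rfl⟩, hpc'⟩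
    · exact union_subset (union_subset (hpiece c A hA) (hpiece m B hB)) (hpiece q C hC)
  rw [heq]
  have hpreA : IsPreconnected A := by
    rw [hA]; split_ifs
    · exact isPreconnected_seg2_inter_sqCell c k c
    · exact isPreconnected_empty
  have hpreB : IsPreconnected B := by
    rw [hB]; split_ifs
    · exact isPreconnected_seg2_inter_sqCell c k m
    · exact isPreconnected_empty
  have hpreC : IsPreconnected C := by
    rw [hC]; split_ifs
    · exact isPreconnected_seg2_inter_sqCell c k q
    · exact isPreconnected_empty
  obtain ⟨h14c, h14m, h34m, h34q⟩ := seg2Pt_quarter_mem c k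
  have h14S : seg2Pt c k (1 / 4) ∈ S := ⟨1 / 4, ⟨by norm_num, by norm_num⟩, rfl⟩
  have h34S : seg2Pt c k (3 / 4) ∈ S := ⟨3 / 4, ⟨by norm_num, by norm_num⟩, rfl⟩
  by_cases hmU : m ∈ U
  · -- the middle cell glues the two ends
    have hBeq : B = S ∩ sqCell m := by rw [hB, if_pos hmU]
    have hAB : IsPreconnected (A ∪ B) := by
      by_cases hcU : c ∈ U
      · have hAeq : A = S ∩ sqCell c := by rw [hA, if_pos hcU]
        exact IsPreconnected.union (seg2Pt c k (1 / 4)) (by rw [hAeq]; exact ⟨h14S, h14c⟩)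
          (by rw [hBeq]; exact ⟨h14S, h14m⟩) hpreA hpreB
      · have hAeq : A = ∅ := by rw [hA, if_neg hcU]
        rw [hAeq, empty_union]; exact hpreB
    by_cases hqU : q ∈ U
    · have hCeq : C = S ∩ sqCell q := by rw [hC, if_pos hqU]
      exact IsPreconnected.union (seg2Pt c k (3 / 4)) (Or.inr (by rw [hBeq]; exact ⟨h34S, h34m⟩))
        (by rw [hCeq]; exact ⟨h34S, h34q⟩) hAB hpreC
    · have hCeq : C = ∅ := by rw [hC, if_neg hqU]
      rw [hCeq, union_empty]; exact hAB
  · -- no middle cell: not both ends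
    have hBeq : B = ∅ := by rw [hB, if_neg hmU]
    rw [hBeq, union_empty]
    by_cases hcU : c ∈ U
    · have hqU : q ∉ U := fun hqU => hmU (hslit hcU hqU)
      have hCeq : C = ∅ := by rw [hC, if_neg hqU]
      rw [hCeq, union_empty]; exact hpreA
    · have hAeq : A = ∅ := by rw [hA, if_neg hcU]
      rw [hAeq, empty_union]; exact hpreC

end CellComplex

end Literature.Probability.Percolation

end
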